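import Summits.QuantumFields.BalabanUV.T4Continuum.Support.NE7K1LinHomKernel

/-!
# NE7K1LinHomKernelSums — row NE7 (node U5), candidate route HOM, path H1L, cell K1-lin(s): the interpolation kernel's SUPPORT,
# VALUES and ABSOLUTE ROW ∕ COLUMN SUMS (`ρ₀ = 3∕2`, `ρ₁ = 5∕3`), plus the bookkeeping of three-point supports

Lineage `b2b-balaban-t4-ne7-p2` (CRUX PROVER NE7 #2), generation 66; continues `NE7K1LinHomKernel`.  All [folklore]:

* §4 bookkeeping: `Σ_{t<NL} f t = Σ_{X<N}Σ_{j<L} f(LX+j)` (`sum_range_mul`), casts `range N ↪ ℤ`, the THREE-POINT SUPPORT bound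
  `Σ_S |f| ≤ |f(a−1)| + |f a| + |f(a+1)|` for `f` vanishing off `{a−1,a,a+1}`, the core row inequality
  `p|ℓ|∕2 + |1 − qr∕2 − pℓ∕2| + q|r|∕2 ≤ 3∕2` (`row_core`), the midpoint-convexity device `6|a| ≤ G(a+3) − G(a−3)`, `G(a) = a|a|∕2`
  (`six_abs_le`) and the SHARP INCREMENT SUM `Σ_{j<L−1}|6j+6−4L| ≤ ((2L−3)² + (4L−3)²)∕12` (`sum_abs_incr_le`, telescoping).
* §5 the kernel vanishes off the three neighbouring coarse sites (`kerF_far`); its values there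
  (`kerF_pred_val ∕ kerF_self_val ∕ kerF_succ_val`: `[1≤X]ℓ_j∕2`, `1 − [X+1<N]r_j∕2 − [1≤X]ℓ_j∕2`, `[X+1<N]r_j∕2`); the ROW SUM
  `Σ_Y |k̃(t,Y)| ≤ 3∕2` (`kerF_row_abs`) and the COLUMN SUM `Σ_t |k̃(t,Y)| ≤ (5∕3)L` (`kerF_col_abs`; exact value `L + Σ_j|ℓ_j|`).

HONEST FRAMING: elementary real analysis of ONE explicit piecewise-quadratic kernel on `ℤ` ([folklore]); no lattice field, no
operator of Bałaban's; it serves the homogenised upper two-run constant of `NE7K1LinHomUpper` (Gaussian `A = 0`, one RG step,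
`U = 1`).  FIXED FINITE T⁴, rung (B)+1; NE7 NOT PRINTED ∕ NOT PROVED; spine 0∕9; NOT infinite volume, NOT mass gap, NOT Clay.  HONEST
DEPENDENCY: continuum YM on T⁴ ⇐ BetaPertH ∧ nine spine estimates (0/9 proved); BetaPertH ⇐ (D1) ∧ (D4) ∧ CAP+tail; G-an2-4 gates
asym, D1 and NE2/3/4.
-/

noncomputable section

open Finset

namespace Summit.QuantumFields.BalabanUV.T4Continuum.NE7K1LinHomKernelSums

open NE7K1LinHomKernel

/-! ### §4 Bookkeeping: block reindexing, three-point supports, casts -/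

section Book

/-- `Σ_{t < NL} f t = Σ_{X<N} Σ_{j<L} f(LX + j)`. [folklore] -/
theorem sum_range_mul (f : ℕ → ℝ) (N L : ℕ) :
    ∑ t ∈ range (N * L), f t = ∑ X ∈ range N, ∑ j ∈ range L, f (L * X + j) := by
  induction N with
  | zero => simp
  | succ N ih =>
    rw [Nat.succ_mul, Finset.sum_range_add, ih, Finset.sum_range_succ]
    congr 1
    exact Finset.sum_congr rfl fun j _ => by rw [Nat.mul_comm]

/-- a sum over `range N` as a sum over its image in `ℤ`. [folklore] -/
theorem sum_range_cast (f : ℤ → ℝ) (N : ℕ) :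
    ∑ Y ∈ range N, f (Y : ℤ) = ∑ Y ∈ (range N).image (Nat.cast : ℕ → ℤ), f Y := by
  rw [Finset.sum_image fun a _ b _ h => by exact_mod_cast h]

/-- **THREE-POINT SUPPORT**: a function vanishing off `{a−1, a, a+1}` has `Σ_S |f| ≤ |f(a−1)| + |f a| + |f(a+1)|` over any
finite `S ⊂ ℤ`. [folklore] -/
theorem sum_abs_le_three (S : Finset ℤ) (f : ℤ → ℝ) (a : ℤ)
    (hf : ∀ Y, Y ≠ a - 1 → Y ≠ a → Y ≠ a + 1 → f Y = 0) :
    ∑ Y ∈ S, |f Y| ≤ |f (a - 1)| + |f a| + |f (a + 1)| := by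
  classical
  set T : Finset ℤ := {a - 1, a, a + 1} with hT
  have hzero : ∀ Y, Y ∉ T → f Y = 0 := by
    intro Y hY
    simp only [hT, Finset.mem_insert, Finset.mem_singleton, not_or] at hY
    exact hf Y hY.1 hY.2.1 hY.2.2
  calc ∑ Y ∈ S, |f Y| ≤ ∑ Y ∈ S ∪ T, |f Y| :=
        Finset.sum_le_sum_of_subset_of_nonneg Finset.subset_union_left fun _ _ _ => abs_nonneg _
    _ = ∑ Y ∈ T, |f Y| :=
        (Finset.sum_subset Finset.subset_union_right fun Y _ hY => by rw [hzero Y hY, abs_zero]).symm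
    _ = |f (a - 1)| + |f a| + |f (a + 1)| := by
        rw [hT, Finset.sum_insert (by simp only [Finset.mem_insert, Finset.mem_singleton]; omega),
          Finset.sum_insert (by simp only [Finset.mem_singleton]; omega), Finset.sum_singleton, add_assoc]

/-- the nonnegative variant of the three-point support bound (for block sums of absolute values). [folklore] -/
theorem sum_le_three (S : Finset ℤ) (g : ℤ → ℝ) (a : ℤ) (hg : ∀ Y, 0 ≤ g Y)
    (hf : ∀ Y, Y ≠ a - 1 → Y ≠ a → Y ≠ a + 1 → g Y = 0) :
    ∑ Y ∈ S, g Y ≤ g (a - 1) + g a + g (a + 1) := by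
  simpa only [abs_of_nonneg (hg _)] using sum_abs_le_three S g a hf

/-- the core of the row bound: `p|ℓ|∕2 + |1 − qr∕2 − pℓ∕2| + q|r|∕2 ≤ 3∕2` for `p, q ∈ {0,1}`, `ℓ, r ≤ 1`, `ℓ, r ≥ −1∕3`,
`ℓ + r ≥ −1∕2`. [folklore] -/
theorem row_core {p q l r : ℝ} (hp : p = 0 ∨ p = 1) (hq : q = 0 ∨ q = 1) (hl1 : l ≤ 1) (hr1 : r ≤ 1)
    (hl : -(1 / 3 : ℝ) ≤ l) (hr : -(1 / 3 : ℝ) ≤ r) (hs : -(1 / 2 : ℝ) ≤ l + r) :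
    p * |l| / 2 + |1 - q * r / 2 - p * l / 2| + q * |r| / 2 ≤ 3 / 2 := by
  rcases hp with rfl | rfl <;> rcases hq with rfl | rfl <;> rcases abs_cases l with ⟨hl', _⟩ | ⟨hl', _⟩ <;>
    rcases abs_cases r with ⟨hr', _⟩ | ⟨hr', _⟩ <;> rw [hl', hr'] <;>
    first
    | (rw [abs_of_nonneg (by linarith)]; linarith)

/-- `6|a| ≤ G(a+3) − G(a−3)` with `G(a) = a|a|∕2` (midpoint convexity of `|·|`; telescopes along arithmetic progressions of
step 6). [folklore] -/
theorem six_abs_le (a : ℝ) : 6 * |a| ≤ (a + 3) * |a + 3| / 2 - (a - 3) * |a - 3| / 2 := by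
  rcases abs_cases (a + 3) with ⟨h1, _⟩ | ⟨h1, _⟩ <;> rcases abs_cases (a - 3) with ⟨h2, _⟩ | ⟨h2, _⟩ <;>
    rcases abs_cases a with ⟨h3, _⟩ | ⟨h3, _⟩ <;> rw [h1, h2, h3] <;> nlinarith [sq_nonneg (a - 3), sq_nonneg (a + 3)]

/-- **THE SHARP INCREMENT SUM**: `Σ_{j<L−1} |6j + 6 − 4L| ≤ ((2L−3)² + (4L−3)²)∕12` (`= (10L² − 18L + 9)∕6 < (5∕3)L²`).
[folklore] -/
theorem sum_abs_incr_le {L : ℕ} (hL : 1 ≤ L) :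
    ∑ j ∈ range (L - 1), |6 * (j : ℝ) + 6 - 4 * L| ≤ ((2 * (L : ℝ) - 3) ^ 2 + (4 * L - 3) ^ 2) / 12 := by
  have hLr : (1 : ℝ) ≤ L := by exact_mod_cast hL
  have h6 : 6 * ∑ j ∈ range (L - 1), |6 * (j : ℝ) + 6 - 4 * L| ≤
      ∑ j ∈ range (L - 1), ((6 * ((j + 1 : ℕ) : ℝ) + 3 - 4 * L) * |6 * ((j + 1 : ℕ) : ℝ) + 3 - 4 * L| / 2 -
        (6 * (j : ℝ) + 3 - 4 * L) * |6 * (j : ℝ) + 3 - 4 * L| / 2) := by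
    rw [Finset.mul_sum]
    refine Finset.sum_le_sum fun j _ => ?_
    have h := six_abs_le (6 * (j : ℝ) + 6 - 4 * L)
    have e1 : 6 * (j : ℝ) + 6 - 4 * L + 3 = 6 * ((j + 1 : ℕ) : ℝ) + 3 - 4 * L := by push_cast; ring
    have e2 : 6 * (j : ℝ) + 6 - 4 * L - 3 = 6 * (j : ℝ) + 3 - 4 * L := by ring
    rw [e1, e2] at h
    exact h
  rw [Finset.sum_range_sub (fun j : ℕ => (6 * (j : ℝ) + 3 - 4 * L) * |6 * (j : ℝ) + 3 - 4 * L| / 2) (L - 1)] at h6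
  have hcast : ((L - 1 : ℕ) : ℝ) = (L : ℝ) - 1 := by rw [Nat.cast_sub hL]; simp
  rw [hcast] at h6
  have e3 : 6 * ((L : ℝ) - 1) + 3 - 4 * L = 2 * L - 3 := by ring
  have e4 : 6 * ((0 : ℕ) : ℝ) + 3 - 4 * L = -(4 * L - 3) := by push_cast; ring
  rw [e3, e4] at h6
  have h7 : (2 * (L : ℝ) - 3) * |2 * (L : ℝ) - 3| ≤ (2 * (L : ℝ) - 3) ^ 2 := by
    rcases abs_cases (2 * (L : ℝ) - 3) with ⟨h, _⟩ | ⟨h, _⟩ <;> rw [h] <;> nlinarith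
  have h8 : -(4 * (L : ℝ) - 3) * |-(4 * (L : ℝ) - 3)| = -((4 * (L : ℝ) - 3) ^ 2) := by
    rw [abs_neg, abs_of_nonneg (by linarith)]; ring
  rw [h8] at h6
  linarith

end Book


/-! ### §5 Values of the kernels on the three-point support; row and column absolute sums -/

section Values

variable {N L : ℕ}

/-- the coarse indicator `[P]` as a real number. [folklore] -/
theorem ite_zero_or_one (P : Prop) [Decidable P] : (if P then (1 : ℝ) else 0) = 0 ∨ (if P then (1 : ℝ) else 0) = 1 := by
  split_ifs <;> simp

/-- `cum(LX + j, Y) = 0` for `Y ≤ X − 2` (below the segment or two blocks down). [folklore] -/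
theorem cumF_of_le_sub_two {X j Y : ℤ} (hj0 : 0 ≤ j) (hjL : j < L) (hXN : X < N) (hY : Y ≤ X - 2) :
    cumF N L (L * X + j) Y = 0 := by
  by_cases hY0 : Y < 0
  · exact cumF_of_neg _ hY0
  · exact cumF_of_two_le hj0 hjL (by omega) (by omega) hXN

/-- `cum(LX + j, Y) = 1` for `Y ≥ X + 1`. [folklore] -/
theorem cumF_of_succ_le {X j Y : ℤ} (hjL : j < L) (hX0 : 0 ≤ X) (hY : X + 1 ≤ Y) :
    cumF N L (L * X + j) Y = 1 :=
  cumF_of_lt hjL (by omega) (by omega)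

/-- the fine site `LX + j` of block `0 ≤ X < N` lies in the fine segment. [folklore] -/
theorem mem_fine {X j : ℤ} (hX0 : 0 ≤ X) (hXN : X < N) (hj0 : 0 ≤ j) (hjL : j < L) :
    0 ≤ (L : ℤ) * X + j ∧ (L : ℤ) * X + j < N * L := by
  refine ⟨by positivity, ?_⟩
  have h1 : X + 1 ≤ (N : ℤ) := by omega
  nlinarith

/-- **SUPPORT**: `k̃(LX + j, Y) = 0` unless `Y ∈ {X−1, X, X+1}`. [folklore] -/
theorem kerF_far {X j Y : ℤ} (hX0 : 0 ≤ X) (hXN : X < N) (hj0 : 0 ≤ j) (hjL : j < L)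
    (h1 : Y ≠ X - 1) (h2 : Y ≠ X) (h3 : Y ≠ X + 1) : kerF N L (L * X + j) Y = 0 := by
  rw [kerF, if_pos (mem_fine hX0 hXN hj0 hjL)]
  rcases lt_or_gt_of_ne h2 with h | h
  · rw [cumF_of_le_sub_two hj0 hjL hXN (by omega), cumF_of_le_sub_two hj0 hjL hXN (by omega), sub_self]
  · rw [cumF_of_succ_le hjL hX0 (by omega), cumF_of_succ_le hjL hX0 (by omega), sub_self]

/-- value one block down: `k̃(LX + j, X − 1) = [1 ≤ X]·ℓ_j∕2`. [folklore] -/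
theorem kerF_pred_val {X j : ℤ} (hX0 : 0 ≤ X) (hXN : X < N) (hj0 : 0 ≤ j) (hjL : j < L) :
    kerF N L (L * X + j) (X - 1) = (if 1 ≤ X then (1 : ℝ) else 0) * (shapeL L j / 2) := by
  rw [kerF, if_pos (mem_fine hX0 hXN hj0 hjL), cumF_of_le_sub_two (Y := X - 1 - 1) hj0 hjL hXN (by omega), sub_zero]
  split_ifs with h
  · rw [cumF_pred hj0 hjL h hXN, one_mul]
  · rw [cumF_of_neg _ (by omega), zero_mul]

/-- value on the own block: `k̃(LX + j, X) = (1 − [X+1 < N]·r_j∕2) − [1 ≤ X]·ℓ_j∕2`. [folklore] -/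
theorem kerF_self_val {X j : ℤ} (hX0 : 0 ≤ X) (hXN : X < N) (hj0 : 0 ≤ j) (hjL : j < L) :
    kerF N L (L * X + j) X = 1 - (if X + 1 < N then (1 : ℝ) else 0) * (shapeR L j / 2) -
      (if 1 ≤ X then (1 : ℝ) else 0) * (shapeL L j / 2) := by
  rw [kerF, if_pos (mem_fine hX0 hXN hj0 hjL)]
  have ha : cumF N L (L * X + j) X = 1 - (if X + 1 < N then (1 : ℝ) else 0) * (shapeR L j / 2) := by
    split_ifs with h
    · rw [cumF_self hj0 hjL hX0 h, one_mul]
    · rw [cumF_of_last_le _ hX0 (by omega), zero_mul, sub_zero]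
  have hb : cumF N L (L * X + j) (X - 1) = (if 1 ≤ X then (1 : ℝ) else 0) * (shapeL L j / 2) := by
    split_ifs with h
    · rw [cumF_pred hj0 hjL h hXN, one_mul]
    · rw [cumF_of_neg _ (by omega), zero_mul]
  rw [ha, hb]

/-- value one block up: `k̃(LX + j, X + 1) = [X+1 < N]·r_j∕2`. [folklore] -/
theorem kerF_succ_val {X j : ℤ} (hX0 : 0 ≤ X) (hXN : X < N) (hj0 : 0 ≤ j) (hjL : j < L) :
    kerF N L (L * X + j) (X + 1) = (if X + 1 < N then (1 : ℝ) else 0) * (shapeR L j / 2) := by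
  rw [kerF, if_pos (mem_fine hX0 hXN hj0 hjL)]
  have e : X + 1 - 1 = X := by ring
  rw [e]
  split_ifs with h
  · rw [cumF_of_succ_le hjL hX0 le_rfl, cumF_self hj0 hjL hX0 h]; ring
  · rw [cumF_of_last_le _ (by omega) (by omega), cumF_of_last_le _ hX0 (by omega)]; ring

/-- **ROW SUM OF THE INTERPOLATION KERNEL**: `Σ_{Y<N} |k̃(t, Y)| ≤ 3∕2` at every fine site `t = LX + j` (`ρ₀ = 3∕2`).
[folklore] -/
theorem kerF_row_abs (hL : 1 ≤ L) {X j : ℤ} (hX0 : 0 ≤ X) (hXN : X < N) (hj0 : 0 ≤ j) (hjL : j < L) :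
    ∑ Y ∈ range N, |kerF N L (L * X + j) Y| ≤ 3 / 2 := by
  rw [sum_range_cast (fun Y => |kerF N L (L * X + j) Y|) N]
  refine (sum_abs_le_three _ _ X fun Y h1 h2 h3 => kerF_far hX0 hXN hj0 hjL h1 h2 h3).trans ?_
  rw [kerF_pred_val hX0 hXN hj0 hjL, kerF_self_val hX0 hXN hj0 hjL, kerF_succ_val hX0 hXN hj0 hjL]
  set p : ℝ := if 1 ≤ X then (1 : ℝ) else 0 with hp
  set q : ℝ := if X + 1 < N then (1 : ℝ) else 0 with hq
  have hp' : p = 0 ∨ p = 1 := ite_zero_or_one _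
  have hq' : q = 0 ∨ q = 1 := ite_zero_or_one _
  have h := row_core hp' hq' (shapeL_le_one hL hj0 hjL) (shapeR_le_one hL hj0 hjL) (shapeL_ge hL) (shapeR_ge hL)
    (shapeL_add_shapeR_ge hL) (l := shapeL L j) (r := shapeR L j)
  have e1 : |p * (shapeL L j / 2)| = p * |shapeL L j| / 2 := by
    rcases hp' with h0 | h0 <;> rw [h0] <;> simp [abs_div]
  have e2 : |q * (shapeR L j / 2)| = q * |shapeR L j| / 2 := by
    rcases hq' with h0 | h0 <;> rw [h0] <;> simp [abs_div]
  have e3 : (1 : ℝ) - q * (shapeR L j / 2) - p * (shapeL L j / 2) = 1 - q * shapeR L j / 2 - p * shapeL L j / 2 := by ring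
  rw [e1, e2, e3]
  exact h

/-- `Σ_{j<L} |ℓ_j| ≤ (2∕3)L` (`|ℓ| ≤ ℓ + 2∕3` since `ℓ ≥ −1∕3`, and `Σ ℓ_j = 0`). [folklore] -/
theorem sum_abs_shapeL_le (hL : 1 ≤ L) : ∑ j ∈ range L, |shapeL L (j : ℤ)| ≤ 2 / 3 * L := by
  have h : ∀ j ∈ range L, |shapeL L (j : ℤ)| ≤ shapeL L (j : ℤ) + 2 / 3 := by
    intro j _
    have := shapeL_ge hL (j := (j : ℤ))
    rcases abs_cases (shapeL L (j : ℤ)) with ⟨h, _⟩ | ⟨h, _⟩ <;> rw [h] <;> linarith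
  refine (Finset.sum_le_sum h).trans ?_
  rw [Finset.sum_add_distrib, sum_shapeL, Finset.sum_const, Finset.card_range, nsmul_eq_mul]
  linarith

/-- `Σ_{j<L} |r_j| ≤ (2∕3)L`. [folklore] -/
theorem sum_abs_shapeR_le (hL : 1 ≤ L) : ∑ j ∈ range L, |shapeR L (j : ℤ)| ≤ 2 / 3 * L := by
  have h : ∀ j ∈ range L, |shapeR L (j : ℤ)| = |shapeL L ((L - 1 - j : ℕ) : ℤ)| := by
    intro j hj
    rw [Finset.mem_range] at hj
    unfold shapeR
    congr 2
    omega
  rw [Finset.sum_congr rfl h, Finset.sum_range_reflect (fun j => |shapeL L (j : ℤ)|) L]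
  exact sum_abs_shapeL_le hL

/-- a fine site `LX + j` with `X` outside `[0,N)` lies outside the fine segment. [folklore] -/
theorem not_mem_fine {X : ℤ} (hX : ¬ (0 ≤ X ∧ X < N)) {j : ℕ} (hjL : j < L) :
    ¬ (0 ≤ (L : ℤ) * X + j ∧ (L : ℤ) * X + j < N * L) := by
  intro h
  apply hX
  constructor
  · by_contra hX0
    have : (L : ℤ) * X + j < 0 := by nlinarith
    omega
  · by_contra hXN
    have : (N : ℤ) * L ≤ (L : ℤ) * X + j := by nlinarith
    omega

/-- a kernel block sum vanishes outside the segment. [folklore] -/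
theorem blockSum_kerF_out {Y X : ℤ} (hX : ¬ (0 ≤ X ∧ X < N)) :
    ∑ j ∈ range L, |kerF N L (L * X + j) Y| = 0 := by
  refine Finset.sum_eq_zero fun j hj => ?_
  rw [abs_eq_zero]
  exact kerF_of_not_mem (not_mem_fine hX (Finset.mem_range.1 hj)) Y

/-- a kernel block sum vanishes off the three neighbouring blocks. [folklore] -/
theorem blockSum_kerF_far {Y X : ℤ} (h1 : X ≠ Y - 1) (h2 : X ≠ Y) (h3 : X ≠ Y + 1) :
    ∑ j ∈ range L, |kerF N L (L * X + j) Y| = 0 := by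
  by_cases hX : 0 ≤ X ∧ X < N
  · refine Finset.sum_eq_zero fun j hj => ?_
    have hjL := Finset.mem_range.1 hj
    rw [abs_eq_zero]
    exact kerF_far hX.1 hX.2 (by positivity) (by exact_mod_cast hjL) (by omega) (by omega) (by omega)
  · exact blockSum_kerF_out hX

/-- **COLUMN SUM OF THE INTERPOLATION KERNEL**: `Σ_{t<NL} |k̃(t, Y)| ≤ (5∕3)L` at every coarse site (`ρ₁ = 5∕3`; the exact
value is `L + Σ_j|ℓ_j| ≈ 1.30L`). [folklore] -/
theorem kerF_col_abs (hL : 1 ≤ L) {Y : ℤ} (hY0 : 0 ≤ Y) (hYN : Y < N) :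
    ∑ t ∈ range (N * L), |kerF N L t Y| ≤ 5 / 3 * L := by
  rw [sum_range_mul (fun t => |kerF N L t Y|) N L]
  push_cast
  rw [sum_range_cast (fun X => ∑ j ∈ range L, |kerF N L (L * X + j) Y|)]
  refine (sum_le_three _ _ Y (fun X => Finset.sum_nonneg fun _ _ => abs_nonneg _)
    (fun X h1 h2 h3 => blockSum_kerF_far h1 h2 h3)).trans ?_
  -- the three blocks
  have hdown : ∑ j ∈ range L, |kerF N L (L * (Y - 1) + j) Y| ≤ ∑ j ∈ range L, |shapeR L (j : ℤ)| / 2 := by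
    by_cases hY1 : 1 ≤ Y
    · refine Finset.sum_le_sum fun j hj => ?_
      have hjL := Finset.mem_range.1 hj
      have hv := kerF_succ_val (N := N) (L := L) (X := Y - 1) (j := (j : ℤ)) (by omega) (by omega) (by positivity)
        (by exact_mod_cast hjL)
      rw [show Y - 1 + 1 = Y by ring] at hv
      rw [hv, if_pos hYN, one_mul, abs_div, abs_two]
    · rw [blockSum_kerF_out (X := Y - 1) (Y := Y) (by omega)]
      exact Finset.sum_nonneg fun _ _ => by positivity
  have hself : ∑ j ∈ range L, |kerF N L (L * Y + j) Y| = L := by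
    have h : ∀ j ∈ range L, |kerF N L (L * Y + j) Y| = 1 - (if Y + 1 < N then (1 : ℝ) else 0) * (shapeR L j / 2) -
        (if 1 ≤ Y then (1 : ℝ) else 0) * (shapeL L j / 2) := by
      intro j hj
      have hjL := Finset.mem_range.1 hj
      rw [kerF_self_val hY0 hYN (by positivity) (by exact_mod_cast hjL)]
      refine abs_of_nonneg ?_
      have h1 := shapeL_le_one hL (j := (j : ℤ)) (by positivity) (by exact_mod_cast hjL)
      have h2 := shapeR_le_one hL (j := (j : ℤ)) (by positivity) (by exact_mod_cast hjL)
      rcases ite_zero_or_one (Y + 1 < (N : ℤ)) with hq | hq <;> rcases ite_zero_or_one (1 ≤ Y) with hp | hp <;>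
        rw [hq, hp] <;> linarith
    rw [Finset.sum_congr rfl h, Finset.sum_sub_distrib, Finset.sum_sub_distrib, Finset.sum_const, Finset.card_range,
      nsmul_eq_mul, mul_one, ← Finset.mul_sum, ← Finset.mul_sum, ← Finset.sum_div, ← Finset.sum_div, sum_shapeR,
      sum_shapeL]
    simp
  have hup : ∑ j ∈ range L, |kerF N L (L * (Y + 1) + j) Y| ≤ ∑ j ∈ range L, |shapeL L (j : ℤ)| / 2 := by
    by_cases hY1 : Y + 1 < N
    · refine Finset.sum_le_sum fun j hj => ?_
      have hjL := Finset.mem_range.1 hj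
      have hv := kerF_pred_val (N := N) (L := L) (X := Y + 1) (j := (j : ℤ)) (by omega) hY1 (by positivity)
        (by exact_mod_cast hjL)
      rw [show Y + 1 - 1 = Y by ring] at hv
      rw [hv, if_pos (by omega), one_mul, abs_div, abs_two]
    · rw [blockSum_kerF_out (X := Y + 1) (Y := Y) (by omega)]
      exact Finset.sum_nonneg fun _ _ => by positivity
  have h1 := sum_abs_shapeL_le hL
  have h2 := sum_abs_shapeR_le hL
  rw [← Finset.sum_div] at hdown hup
  linarith

end Values

end Summit.QuantumFields.BalabanUV.T4Continuum.NE7K1LinHomKernelSums
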